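import Summits.Ventures.HodgeRepro2.T6N43BergmanNSide
import Summits.Ventures.HodgeRepro2.T6N42ToyNSideP

/-!
# T6N43BergmanNSideP — the two seam halves coincide (t6-p6's `bergmanNSide` = t6-p5's `toyNSideP` at the Bergman toy)

The toy N4 side of the M2 carrier at the Bergman-explicit N4.3 bundle was built twice, from the two
ends of the t6-p5 × t6-p6 seam (STATUS ll. 11168 (3), 11241, 11250 (2), 11252 (1), 11271 (1)):
t6-p6's `N43Toy.bergmanNSide := { N42ToyNSide.toyNSide with d43 := bergmanToy.toPlaces }`
(T6N43BergmanNSide, p406830) and t6-p5's parametric `N42ToyNSideP.toyNSideP (d43) (Larch)`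
(T6N42ToyNSideP, p406754), whose real-place factors are the parameter `Larch`. This file records that
they are the same `NSide` — by `rfl` at the N4.3 toys' factors `toyLvArch` (`toyD41P toyLvArch = toyD41`,
t6-p5's `toyD41P_toyLvArch`), and, through `bergmanLfac = toyLvArch` (the Bergman toy's factors ARE the
N4.3 toys' own: `bergmanU11.Lfac := toyU11.Lfac`, `explicitU2.Lfac := toyU2.Lfac`), at the Bergman
bundle's own factors `bergmanLfac` as well. Consequently either spelling serves the joint toy of the M2
object (v6, `periodInputN_of_published₆`), and t6-p5's `toyNSideP_N4` instantiates to `bergmanNSide_N4`.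
Axioms: {propext, Classical.choice, Quot.sound}. §8(d): uses an L-value-free non-vanishing device: NO.
-/

namespace Summit.Ventures.HodgeRepro2.T6

namespace N43Toy

open N42ToyNSide N42ToyNSideP

/-- The Bergman toy bundle's own archimedean `L`-factors, as the parameter of t6-p5's parametric side:
`toyU2.Lfac` at the compact place, `toyU11.Lfac` at the two (1,1)-places. -/
noncomputable def bergmanLfac : Fin 3 → ℂ → ℂ
  | 0 => bergmanToy.p₁.Lfac
  | 1 => bergmanToy.p₂.Lfac
  | 2 => bergmanToy.p₃.Lfac

/-- The Bergman toy's factors are the N4.3 toys' factors `toyLvArch` (the definitions of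
`explicitU2` / `bergmanU11`). -/
theorem bergmanLfac_eq_toyLvArch : bergmanLfac = toyLvArch := by
  funext j
  fin_cases j <;> rfl

/-- The two seam halves coincide at the N4.3 toys' factors: `bergmanNSide` IS t6-p5's parametric side at
the Bergman toy bundle and `toyLvArch` (definitionally: `toyD41P toyLvArch = toyD41`). -/
theorem bergmanNSide_eq_toyNSideP : bergmanNSide = toyNSideP bergmanToy.toPlaces toyLvArch := rfl

/-- … and at the Bergman bundle's own factors. -/
theorem bergmanNSide_eq_toyNSideP_bergmanLfac :
    bergmanNSide = toyNSideP bergmanToy.toPlaces bergmanLfac := by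
  rw [bergmanLfac_eq_toyLvArch]
  exact bergmanNSide_eq_toyNSideP

/-- t6-p5's parametric N4 conclusion, instantiated at the Bergman toy bundle: the same statement as
`bergmanNSide_N4`, reached through `toyNSideP_N4` with the bundle's construction lemmas
(`datum_characterCoefficient`, `datum_fockLineIdentification`, `datum_lowestWeightCoefficient`) and
the five displays. -/
theorem toyNSideP_bergman_N4 :
    (toyNSideP bergmanToy.toPlaces toyLvArch).R1AndHloc ∧
      (toyNSideP bergmanToy.toPlaces toyLvArch).ArchNonvanishing :=
  toyNSideP_N4 bergmanToy.toPlaces toyLvArch bergmanToy.p₁.datum_characterCoefficient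
    bergmanNSide_EL₁ bergmanToy.p₂.datum_fockLineIdentification
    bergmanToy.p₂.datum_lowestWeightCoefficient bergmanNSide_A2f₂ bergmanNSide_EL₂
    bergmanToy.p₃.datum_fockLineIdentification bergmanToy.p₃.datum_lowestWeightCoefficient
    bergmanNSide_A2f₃ bergmanNSide_EL₃

/-- The two derivations of N4 on the side agree (the statements coincide by `bergmanNSide_eq_toyNSideP`). -/
theorem bergmanNSide_N4' : bergmanNSide.R1AndHloc ∧ bergmanNSide.ArchNonvanishing :=
  toyNSideP_bergman_N4

end N43Toy

end Summit.Ventures.HodgeRepro2.T6
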